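import Mathlib
import HarnessLib

/-!
# Decision-tree Harris inequality for monotonic measures (replaces Gladkov's product-only Thm 3.2)

Topic `Summits/CriticalPhenomena/PercolationContinuityZ3` (FK sub-lane of the post-continuity programme,
memo `run/shared/lean/prim/bschramm/FK-Q2.md` §3.1). builds on p205010 (kernel theorem, internal audit
signed; external expert review pending) only as lane framing — this file imports nothing from the chain.

Setting: a finite configuration type `Ω`, coordinates `X : ι → Set Ω` ("edge `e` is open" = `X e`), a
nonnegative weight `μ : Ω → ℝ` (an unnormalised finite measure, `mass μ S = ∑_{ω ∈ S} μ ω`), and a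
DECISION TREE `t : DTr ι`: each internal node queries one coordinate and descends to the `X e`-branch or
the `(X e)ᶜ`-branch; `t.cyl X ω` is the cylinder of configurations answering every query like `ω`.
MONOTONICITY is assumed in the conditional, division-free form in which the tree uses it: for the two
fixed increasing events `A`, `B` and every context `C` in a family `P` stable under refinement by
queries, `μ(A | C, e closed) ≤ μ(A | C, e open)`, i.e.
`mass(A ∩ (C ∩ (X e)ᶜ)) · mass(C ∩ X e) ≤ mass(A ∩ (C ∩ X e)) · mass(C ∩ (X e)ᶜ)` — for a positive measure
this is Grimmett 2006 Thm. (2.24)(c) (monotonic ⇔ FKG lattice condition), for the random-cluster measure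
with `q ≥ 1` it is the tree's `rcMeasure_real_cond_mono` (`RandomClusterMonotonic.lean`), and it is the
definition of a monotonic measure in Duminil-Copin–Raoufi–Tassion 2019 (p. 3).

THEOREM (`DTr.mass_mul_mass_le_sum_condProd`): `μ(A) μ(B) ≤ μ(Ω) · ∑_ω μ(ω) μ(A | cyl_t ω) μ(B | cyl_t ω)`,
i.e. `E_μ[ μ(A | 𝓕_t) μ(B | 𝓕_t) ] ≥ μ(A) μ(B)` after normalisation: the conditional probabilities of two
increasing events given the information revealed by ANY decision tree are positively correlated. For a
product measure this is Gladkov's decision-tree Harris–Kleitman inequality (arXiv:2408.08457v2, Thm. 3.2,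
whose proof — Lemma 3.1, a `μ⊗μ`-preserving pair swap — is product-only); the present statement and
proof (induction on the tree; at each node the two-point Chebyshev inequality
`π a₁b₁ + (1−π) a₀b₀ ≥ (π a₁ + (1−π)a₀)(π b₁ + (1−π)b₀)` for `a₁ ≥ a₀`, `b₁ ≥ b₀`) hold for every monotonic
measure. Not found in print in this form (FK-Q2.md §3.1 presearch). This is the device behind
"cluster-conditional Harris" (CE) of the p205010 chain (`HullPort.CE_holds`), now available for FK(q ≥ 1)
and for any FKG-lattice measure.

## References
* N. Gladkov, *Percolation inequalities and decision trees*, arXiv:2408.08457v2 (2024), Lemma 3.1, Thm. 3.2.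
* H. Duminil-Copin, A. Raoufi, V. Tassion, Ann. of Math. 189 (2019) 75–99, p. 3 (monotonic measures).
* G. Grimmett, *The Random-Cluster Model* (2006), Thm. (2.24), Thm. (3.8)(b).
-/

noncomputable section

open Finset
open scoped Classical

namespace Summit.CriticalPhenomena.PercolationContinuityZ3.Theorems.MonotonicTree

variable {ι Ω : Type*}

/-! ### Decision trees and their cylinders -/

/-- A decision tree over coordinates `ι`: a leaf, or a node querying `e : ι` with a subtree for the
answer "`e` closed" (`t0`) and one for "`e` open" (`t1`). -/
inductive DTr (ι : Type*) where
  | leaf : DTr ι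
  | node (e : ι) (t0 t1 : DTr ι) : DTr ι

namespace DTr

/-- The cylinder of configurations giving the same answers as `ω` to every query of the tree. -/
def cyl (X : ι → Set Ω) : DTr ι → Ω → Set Ω
  | leaf, _ => Set.univ
  | node e t0 t1, ω => if ω ∈ X e then X e ∩ cyl X t1 ω else (X e)ᶜ ∩ cyl X t0 ω

/-- A leaf reveals nothing: its cylinder is everything. -/
theorem cyl_leaf (X : ι → Set Ω) (ω : Ω) : cyl X leaf ω = Set.univ := rfl

/-- At a node whose query `ω` answers "open", the cylinder is `X e ∩` (cylinder of the open subtree). -/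
theorem cyl_node_of_mem (X : ι → Set Ω) {e : ι} (t0 t1 : DTr ι) {ω : Ω} (h : ω ∈ X e) :
    cyl X (node e t0 t1) ω = X e ∩ cyl X t1 ω := by
  simp [cyl, h]

/-- At a node whose query `ω` answers "closed", the cylinder is `(X e)ᶜ ∩` (cylinder of the closed subtree). -/
theorem cyl_node_of_not_mem (X : ι → Set Ω) {e : ι} (t0 t1 : DTr ι) {ω : Ω} (h : ω ∉ X e) :
    cyl X (node e t0 t1) ω = (X e)ᶜ ∩ cyl X t0 ω := by
  simp [cyl, h]

/-- The arithmetic heart of the node step: two-point Chebyshev with the monotonicity cross terms,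
in division-free form with the degenerate branches included. -/
theorem node_ineq {a0 a1 b0 b1 c0 c1 S0 S1 : ℝ}
    (ha0 : 0 ≤ a0) (ha1 : 0 ≤ a1) (hb0 : 0 ≤ b0) (hb1 : 0 ≤ b1) (hc0 : 0 ≤ c0) (hc1 : 0 ≤ c1)
    (hS0 : 0 ≤ S0) (hS1 : 0 ≤ S1)
    (hac1 : a1 ≤ c1) (hbc1 : b1 ≤ c1) (hac0 : a0 ≤ c0) (hbc0 : b0 ≤ c0)
    (h1 : a1 * b1 ≤ c1 * S1) (h0 : a0 * b0 ≤ c0 * S0)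
    (hma : a0 * c1 ≤ a1 * c0) (hmb : b0 * c1 ≤ b1 * c0) :
    (a1 + a0) * (b1 + b0) ≤ (c1 + c0) * (S1 + S0) := by
  rcases hc1.eq_or_lt with hc1' | hc1'
  · have ha1' : a1 = 0 := le_antisymm (hc1' ▸ hac1) ha1
    have hb1' : b1 = 0 := le_antisymm (hc1' ▸ hbc1) hb1
    subst ha1' hb1'
    nlinarith
  rcases hc0.eq_or_lt with hc0' | hc0'
  · have ha0' : a0 = 0 := le_antisymm (hc0' ▸ hac0) ha0
    have hb0' : b0 = 0 := le_antisymm (hc0' ▸ hbc0) hb0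
    subst ha0' hb0'
    nlinarith
  have hkey : 0 ≤ c0 * c1 * ((c1 + c0) * (S1 + S0) - (a1 + a0) * (b1 + b0)) := by
    have hx : 0 ≤ (a1 * c0 - a0 * c1) * (b1 * c0 - b0 * c1) :=
      mul_nonneg (by linarith) (by linarith)
    nlinarith [mul_le_mul_of_nonneg_left h1 (mul_nonneg hc0 hc0),
      mul_le_mul_of_nonneg_left h1 (mul_nonneg hc0 hc1'.le),
      mul_le_mul_of_nonneg_left h0 (mul_nonneg hc1'.le hc1'.le),
      mul_le_mul_of_nonneg_left h0 (mul_nonneg hc0 hc1'.le)]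
  have hpos : 0 < c0 * c1 := mul_pos hc0' hc1'
  nlinarith

end DTr

/-! ### Masses -/

section Mass

variable [Fintype Ω]

/-- The mass `μ(S) = ∑_{ω ∈ S} μ(ω)` of a set under a weight function (a sum of `if`s over `Ω`). -/
def mass (μ : Ω → ℝ) (S : Set Ω) : ℝ := ∑ ω, if ω ∈ S then μ ω else 0

/-- Masses are nonnegative for nonnegative weights. -/
theorem mass_nonneg {μ : Ω → ℝ} (hμ : ∀ ω, 0 ≤ μ ω) (S : Set Ω) : 0 ≤ mass μ S :=
  sum_nonneg fun ω _ => by split_ifs <;> simp [hμ ω]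

/-- Mass is monotone under inclusion (nonnegative weights). -/
theorem mass_mono {μ : Ω → ℝ} (hμ : ∀ ω, 0 ≤ μ ω) {S T : Set Ω} (h : S ⊆ T) :
    mass μ S ≤ mass μ T := by
  refine sum_le_sum fun ω _ => ?_
  by_cases hS : ω ∈ S
  · simp [hS, h hS]
  · by_cases hT : ω ∈ T
    · simp [hS, hT, hμ ω]
    · simp [hS, hT]

/-- Splitting a mass along a coordinate: `μ(S ∩ E) + μ(S ∩ Eᶜ) = μ(S)`. -/
theorem mass_inter_add_inter_compl (μ : Ω → ℝ) (S E : Set Ω) :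
    mass μ (S ∩ E) + mass μ (S ∩ Eᶜ) = mass μ S := by
  unfold mass
  rw [← sum_add_distrib]
  refine sum_congr rfl fun ω _ => ?_
  by_cases hS : ω ∈ S
  · by_cases hE : ω ∈ E
    · simp [hS, hE]
    · simp [hS, hE]
  · simp [hS]

namespace DTr

/-- The node term of the theorem: `μ(ω) · μ(A | C ∩ cyl ω) · μ(B | C ∩ cyl ω)` (real division, `x/0 = 0`). -/
def condProd (μ : Ω → ℝ) (X : ι → Set Ω) (A B C : Set Ω) (t : DTr ι) (ω : Ω) : ℝ :=
  μ ω * (mass μ (A ∩ (C ∩ t.cyl X ω)) / mass μ (C ∩ t.cyl X ω)) *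
    (mass μ (B ∩ (C ∩ t.cyl X ω)) / mass μ (C ∩ t.cyl X ω))

/-- The node terms are nonnegative. -/
theorem condProd_nonneg {μ : Ω → ℝ} (hμ : ∀ ω, 0 ≤ μ ω) (X : ι → Set Ω) (A B C : Set Ω)
    (t : DTr ι) (ω : Ω) : 0 ≤ condProd μ X A B C t ω := by
  unfold condProd
  exact mul_nonneg (mul_nonneg (hμ ω) (div_nonneg (mass_nonneg hμ _) (mass_nonneg hμ _)))
    (div_nonneg (mass_nonneg hμ _) (mass_nonneg hμ _))

/-- The restricted sum `∑_{ω ∈ C} condProd … C t ω`, as a sum of `if`s over `Ω`. -/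
def csum (μ : Ω → ℝ) (X : ι → Set Ω) (A B C : Set Ω) (t : DTr ι) : ℝ :=
  ∑ ω, if ω ∈ C then condProd μ X A B C t ω else 0

/-- The restricted sums are nonnegative. -/
theorem csum_nonneg {μ : Ω → ℝ} (hμ : ∀ ω, 0 ≤ μ ω) (X : ι → Set Ω) (A B C : Set Ω) (t : DTr ι) :
    0 ≤ csum μ X A B C t :=
  sum_nonneg fun ω _ => by split_ifs <;> simp [condProd_nonneg hμ]

/-- Leaf: `∑_{ω ∈ C} μ(ω) μ(A|C) μ(B|C) = μ(C) · μ(A|C) μ(B|C)`. -/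
theorem csum_leaf (μ : Ω → ℝ) (X : ι → Set Ω) (A B C : Set Ω) :
    csum μ X A B C leaf =
      mass μ C * ((mass μ (A ∩ C) / mass μ C) * (mass μ (B ∩ C) / mass μ C)) := by
  have h : ∀ ω, (if ω ∈ C then condProd μ X A B C leaf ω else 0) =
      (if ω ∈ C then μ ω else 0) * ((mass μ (A ∩ C) / mass μ C) * (mass μ (B ∩ C) / mass μ C)) := by
    intro ω
    simp only [condProd, cyl_leaf, Set.inter_univ]
    split_ifs <;> ring
  unfold csum
  simp_rw [h]
  rw [← sum_mul]
  rfl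

/-- Node: the restricted sum splits along the answer at `e` into the two subtrees with refined contexts. -/
theorem csum_node (μ : Ω → ℝ) (X : ι → Set Ω) (A B C : Set Ω) (e : ι) (t0 t1 : DTr ι) :
    csum μ X A B C (node e t0 t1) =
      csum μ X A B (C ∩ X e) t1 + csum μ X A B (C ∩ (X e)ᶜ) t0 := by
  unfold csum
  rw [← sum_add_distrib]
  refine sum_congr rfl fun ω _ => ?_
  by_cases hC : ω ∈ C
  · by_cases he : ω ∈ X e
    · simp only [hC, condProd, cyl_node_of_mem X t0 t1 he, ← Set.inter_assoc, Set.mem_inter_iff, he,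
        and_self, ↓reduceIte, Set.mem_compl_iff, not_true_eq_false, and_false, add_zero]
    · simp only [hC, condProd, cyl_node_of_not_mem X t0 t1 he, ← Set.inter_assoc, Set.mem_inter_iff,
        he, and_false, ↓reduceIte, Set.mem_compl_iff, not_false_eq_true, and_self, zero_add]
  · simp [hC]

variable (μ : Ω → ℝ) (X : ι → Set Ω) (P : Set Ω → Prop) (A B : Set Ω)

/-- **Decision-tree Harris inequality for monotonic measures, conditional form.** For every tree `t`
and every context `C` in a query-stable family `P` on which `A` and `B` are conditionally monotone
(increasing events under a monotonic measure):
`μ(A ∩ C) μ(B ∩ C) ≤ μ(C) · ∑_{ω ∈ C} μ(ω) μ(A | C ∩ cyl_t ω) μ(B | C ∩ cyl_t ω)`. -/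
theorem mass_mul_mass_le_csum (hμ : ∀ ω, 0 ≤ μ ω)
    (hP : ∀ C e, P C → P (C ∩ X e) ∧ P (C ∩ (X e)ᶜ))
    (hA : ∀ C e, P C → mass μ (A ∩ (C ∩ (X e)ᶜ)) * mass μ (C ∩ X e) ≤
      mass μ (A ∩ (C ∩ X e)) * mass μ (C ∩ (X e)ᶜ))
    (hB : ∀ C e, P C → mass μ (B ∩ (C ∩ (X e)ᶜ)) * mass μ (C ∩ X e) ≤
      mass μ (B ∩ (C ∩ X e)) * mass μ (C ∩ (X e)ᶜ))
    (t : DTr ι) : ∀ C, P C → mass μ (A ∩ C) * mass μ (B ∩ C) ≤ mass μ C * csum μ X A B C t := by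
  induction t with
  | leaf =>
    intro C _
    rw [csum_leaf]
    rcases (mass_nonneg hμ C).eq_or_lt with h0 | hpos
    · have hA0 : mass μ (A ∩ C) = 0 :=
        le_antisymm (h0 ▸ mass_mono hμ Set.inter_subset_right) (mass_nonneg hμ _)
      rw [hA0]; simp
    · rw [show mass μ C * (mass μ C * (mass μ (A ∩ C) / mass μ C * (mass μ (B ∩ C) / mass μ C))) =
          mass μ (A ∩ C) * mass μ (B ∩ C) by field_simp]
  | node e t0 t1 ih0 ih1 =>
    intro C hC
    obtain ⟨hC1, hC0⟩ := hP C e hC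
    rw [csum_node]
    have e1 := ih1 (C ∩ X e) hC1
    have e0 := ih0 (C ∩ (X e)ᶜ) hC0
    have hAs := mass_inter_add_inter_compl μ (A ∩ C) (X e)
    have hBs := mass_inter_add_inter_compl μ (B ∩ C) (X e)
    have hCs := mass_inter_add_inter_compl μ C (X e)
    rw [Set.inter_assoc, Set.inter_assoc] at hAs hBs
    rw [← hAs, ← hBs, ← hCs]
    exact node_ineq (mass_nonneg hμ _) (mass_nonneg hμ _) (mass_nonneg hμ _) (mass_nonneg hμ _)
      (mass_nonneg hμ _) (mass_nonneg hμ _) (csum_nonneg hμ X A B _ t0) (csum_nonneg hμ X A B _ t1)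
      (mass_mono hμ Set.inter_subset_right) (mass_mono hμ Set.inter_subset_right)
      (mass_mono hμ Set.inter_subset_right) (mass_mono hμ Set.inter_subset_right)
      e1 e0 (hA C e hC) (hB C e hC)

/-- **Decision-tree Harris inequality for monotonic measures.** If the increasing events `A`, `B` are
conditionally monotone at every query along a query-stable family of contexts containing `univ` (true for
every monotonic / FKG-lattice measure), then for every decision tree `t`,
`μ(A) μ(B) ≤ μ(Ω) · ∑_ω μ(ω) μ(A | cyl_t ω) μ(B | cyl_t ω)` — i.e. `E[μ(A|𝓕_t) μ(B|𝓕_t)] ≥ μ(A)μ(B)` for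
the normalised measure: the revealed conditional probabilities of two increasing events are positively
correlated. -/
theorem mass_mul_mass_le_sum_condProd (hμ : ∀ ω, 0 ≤ μ ω) (hPuniv : P Set.univ)
    (hP : ∀ C e, P C → P (C ∩ X e) ∧ P (C ∩ (X e)ᶜ))
    (hA : ∀ C e, P C → mass μ (A ∩ (C ∩ (X e)ᶜ)) * mass μ (C ∩ X e) ≤
      mass μ (A ∩ (C ∩ X e)) * mass μ (C ∩ (X e)ᶜ))
    (hB : ∀ C e, P C → mass μ (B ∩ (C ∩ (X e)ᶜ)) * mass μ (C ∩ X e) ≤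
      mass μ (B ∩ (C ∩ X e)) * mass μ (C ∩ (X e)ᶜ))
    (t : DTr ι) :
    mass μ A * mass μ B ≤
      mass μ Set.univ * ∑ ω, μ ω * (mass μ (A ∩ t.cyl X ω) / mass μ (t.cyl X ω)) *
        (mass μ (B ∩ t.cyl X ω) / mass μ (t.cyl X ω)) := by
  have h := mass_mul_mass_le_csum μ X P A B hμ hP hA hB t Set.univ hPuniv
  simpa [csum, condProd] using h

end DTr

end Mass

end Summit.CriticalPhenomena.PercolationContinuityZ3.Theorems.MonotonicTree

end
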